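import Summits.BirchSwinnertonDyer.Rank1Residual.X2.IsogenyQuotientLine
import Summits.BirchSwinnertonDyer.Rank1Residual.X2.IsogenyLineType
import Summits.BirchSwinnertonDyer.Rank1Residual.X2.IsogenyLambdaInvariant
import Summits.BirchSwinnertonDyer.Rank1Residual.X2.GreenbergVatsalInputs
import Summits.BirchSwinnertonDyer.Rank1Residual.X2.GreenbergVatsalAnalyticTransferCore
import Literature.NumberTheory.EllipticCurves.GreenbergVatsal2000.IsogenyClassPeriod
import Literature.NumberTheory.EllipticCurves.GreenbergVatsal2000.MultiplicativeLambda
import HarnessLib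

/-!
# GV CASE 2 of the flag `GV00-mult-asserted` — the `λ`/`μ^anal` clause for a rational line
# UNRAMIFIED at `p` and ODD, by Greenberg–Vatsal's isogeny `E → E/Φ₀` — and the flag's named facts
# `lambda_muAnal_multiplicative_of_gvPar` (A64) / `lambdaMu_multiplicative_of_gvPar` (A63) DERIVED
# (cell `b2b-bsdres`, unit `b2b-bsdres-eisenstein-p2`, gen 18)

HONEST FRAMING (run/shared/lean/b2b/bsd-rank1-residual/, verbatim in every file): the goal of the
cell is to DELETE the COMBINATION-SHAPED residual classes of the Birch–Swinnerton-Dyer formula for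
ALL analytic-rank `≤ 1` elliptic curves over `ℚ` — "full BSD formula for every rank `≤ 1` curve in
class `C`" assembled STRICTLY from published theorems — so that the rank-`≤ 1` remainder becomes
exactly the CONSTRUCTION-SHAPED classes, which are TYPED (missing-input `Prop`s), NOT attempted.
This is not "finishing BSD". Research route; NO CLAIM BEYOND STATED CLASSES; nothing here changes
a label (the seat proposes, the referee rules). Theorems only; no definition, no NEW named fact (the
inputs are registered facts, the two typed GV inputs of gen 17, and GV Cor. (3.8) =
`cor38_realPeriodRat_eq_unit_mul_of_isIsogenous_of_gvPar`, filed this gen).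

WHAT. The cell's flag `GV00-mult-asserted` marks the named facts A63
`GreenbergVatsal2000.lambdaMu_multiplicative_of_gvPar` / A64 `…lambda_muAnal_multiplicative_of_gvPar`
(Greenberg–Vatsal's Thm. (1.3) at a MULTIPLICATIVE prime, asserted by the authors, printed for good
ordinary `p`). Gens 8–17 rebuilt the proof at `p ‖ N` in the kernel for CASE 1 of the parity
hypothesis (rational line ramified at `p` and even): `X2.caseOne_clause_of_inputs`. GV treat CASE 2
(line unramified at `p` and odd) on p. 28 by passing to `E' = E/Φ₀`: "A result of Schneider then
implies that the `μ`-invariant … is unchanged by a `p`-isogeny. The `λ`-invariant is always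
unchanged by an isogeny. Thus, we may assume … `φ` is ramified and even". This file performs that
reduction in the kernel:

* §1 Λ-algebra: multiplying `b ∈ Λ` by a unit constant `C(c)` preserves unit content and the
  `T`-order mod `p`; `ι(C(c)·b) = C(c)·ι(b)`.
* §2 **`caseTwo_clause_of_inputs`** — the body of A64 for `(W, p, κ, γ, f, D, ϖ, f_E)` with `GVPar`
  replaced by CASE 2, from: the quotient `E' = E/Φ₀` on a globally minimal model with its
  ramified-even line (`X2/IsogenyQuotientLine`, `X2/IsogenyLineType`; `E'` multiplicative at `p`,
  split iff `E` is, newform `f`); CASE 1 for `E'` (`caseOne_clause_of_inputs`, any dual datum `D'`,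
  `nonempty_selmerDualData_holds`); `μ = 0` for `E` and `E'` (Greenberg 1999 Prop. 5.10, `hG`, both
  parity cases); **`λ(E) = λ(E')` — the KERNEL theorem `IsogenyLambdaInvariant.lambdaInvariant_eq_of_isogeny`**
  (so `ord_T(f_E mod p) = ord_T(f_{E'} mod p)`, `natCast_lambdaInvariant_eq_order_map_toZMod`); and
  the period input GV Cor. (3.8) (`hP`: `Ω_{E'} = u·Ω_E`, `|u|_p = 1`), whence `ϖ' = ϖ/u`,
  `b = C(u)·b'`.
* §3 **`lambda_muAnal_multiplicative_of_gvPar_of_inputs`**: A64 DERIVED (CASE 1 ∨ CASE 2);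
  **`lambdaMu_multiplicative_of_gvPar_of_inputs`**: A63 DERIVED (with Wuthrich Thm. 16, by the
  tree's `lambdaMu_multiplicative_of_gvPar_of_parts`). Every consumer of A63/A64 (the X2a closure of
  record `X2.RankZero.targetA_of_published`, the X2c levers `mainConjecture_{split,nonsplit}_of_gvPar`,
  …) can now be fed these terms: its inputs become the registered published facts + the two typed
  GV inputs at CASE-1 data + Cor. (3.8).

References: [GreenbergVatsal2000] Thm. (1.3), §2 (16) and p. 28, §3 Thm. (3.11), Cor. (3.8);
[GreenbergLNM1716] Prop. 5.10; [Wuthrich2014] Thm. 16; HOME/b2b-bsdres-eisenstein-p2/X2-GAP.md §23.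
-/

set_option autoImplicit false

noncomputable section

open scoped Classical MatrixGroups ModularForm

open PowerSeries NumberField IsDedekindDomain Field WeierstrassCurve CongruenceSubgroup
  Literature.NumberTheory.EllipticCurves Literature.NumberTheory.EllipticCurves.GreenbergVatsal2000
  Literature.NumberTheory.EllipticCurves.ModularForms
  Literature.NumberTheory.EllipticCurves.Rank1Residual
  Summit.BirchSwinnertonDyer.Rank1Residual.X2.IsogenyQuotientLine
  Summit.BirchSwinnertonDyer.Rank1Residual.X2.IsogenyLineType
  Summit.BirchSwinnertonDyer.Rank1Residual.X2.IsogenyLambdaInvariant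
  Summit.BirchSwinnertonDyer.Rank1Residual.X2.GreenbergVatsalAnalyticTransferCore

namespace Summit.BirchSwinnertonDyer.Rank1Residual.X2.GreenbergVatsalCaseTwo

variable {p : ℕ} [hp : Fact p.Prime]

/-! ## §1. Λ-algebra: multiplying by a unit constant -/

/-- For a unit `c ∈ ℤ_pˣ` and `b ∈ Λ`: `C(c)·b` has unit content iff `b` has, and the two reductions
mod `p` have the same `T`-adic order. [folklore] -/
theorem hasUnitContent_and_order_C_mul (c : ℤ_[p]ˣ) (b : IwasawaAlgebra p) :
    (HasUnitContent (PowerSeries.C (c : ℤ_[p]) * b) ↔ HasUnitContent b) ∧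
      (PowerSeries.map (PadicInt.toZMod (p := p)) (PowerSeries.C (c : ℤ_[p]) * b)).order =
        (PowerSeries.map (PadicInt.toZMod (p := p)) b).order := by
  set red := PowerSeries.map (PadicInt.toZMod (p := p)) with hred
  have hu : IsUnit (red (PowerSeries.C (c : ℤ_[p]))) :=
    ((Units.isUnit c).map (PowerSeries.C (R := ℤ_[p]))).map red
  refine ⟨?_, ?_⟩
  · rw [hasUnitContent_iff_map_toZMod_ne_zero, hasUnitContent_iff_map_toZMod_ne_zero, map_mul]
    exact ⟨fun h hb ↦ h (by rw [hb, mul_zero]), fun h hcb ↦ h ((hu.mul_right_eq_zero).mp hcb)⟩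
  · rw [map_mul, PowerSeries.order_mul, PowerSeries.order_zero_of_unit hu, zero_add]

/-- `ι(C(c)·b) = C(c)·ι(b)` for the inclusion `ι : Λ ↪ ℚ_p⟦T⟧`. [folklore] -/
theorem iwasawaToPowerSeries_C_mul (c : ℤ_[p]) (b : IwasawaAlgebra p) :
    iwasawaToPowerSeries p (PowerSeries.C c * b) =
      PowerSeries.C ((c : ℤ_[p]) : ℚ_[p]) * iwasawaToPowerSeries p b := by
  rw [map_mul, PowerSeries.map_C]
  rfl

/-! ## §2. CASE 2 of the clause -/

/-- **GV CASE 2 (rational line UNRAMIFIED at `p` and ODD) of the `λ`/`μ^anal` clause at an odd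
multiplicative prime**, by Greenberg–Vatsal's own reduction (p. 28): the body of
`GreenbergVatsal2000.lambda_muAnal_multiplicative_of_gvPar` for `(W, p, κ, γ, f, D, ϖ, f_E)` with
`GVPar` replaced by its SECOND case, from
* the registered facts A40/A41 (`hT`, `hT'`), A133 (`hA`), A135 (`hB`), A137 (`hF`), Greenberg 1999
  Prop. 5.10 (`hG`) and the typed inputs `GVLiftingInput`/`GVAnalyticInput` at CASE-1 data
  (`hLift`, `hAn`) — through CASE 1 for the quotient `E' = E/Φ₀` (`caseOne_clause_of_inputs`;
  `E'` globally minimal, multiplicative at `p`, split iff `E` is, with the ramified-even line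
  `E[p]/Φ₀`: `X2/IsogenyQuotientLine`, `X2/IsogenyLineType`);
* "the `λ`-invariant is always unchanged by an isogeny" — KERNEL theorem
  `IsogenyLambdaInvariant.lambdaInvariant_eq_of_isogeny`; `μ = 0` on both sides by Prop. 5.10, so
  `ord_T(f_E mod p) = λ(E) = λ(E') = ord_T(f_{E'} mod p)`;
* GV Cor. (3.8) (`hP`, `cor38_realPeriodRat_eq_unit_mul_of_isIsogenous_of_gvPar`): `Ω_{E'} = u·Ω_E`,
  `|u|_p = 1`, so `ϖ' = ϖ/u` and `b = C(u)·b'` — unit content and `T`-order mod `p` unchanged.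
[cite: GreenbergVatsal2000, §2 p. 28, §3 Cor. (3.8)] -/
theorem caseTwo_clause_of_inputs
    (hT : Silverman1994_thmV53_tateUniformisation.{0})
    (hT' : Silverman1994_thmV53_corV54_tateUniformisation.{0})
    (hA : lambda_nonPrimitive_eq_add_sum_delta_multiplicative)
    (hB : datumSelmer_divisible_of_finite_torsionBy)
    (hF : datumStrictSelmer_lt_datumSelmer_of_split)
    (hG : Greenberg1999.prop510_isTorsion_hasUnitContent_of_gvPar)
    (hLift : ∀ (W : WeierstrassCurve ℚ) [W.IsGloballyMinimal] [W.IsElliptic] (p : ℕ) [Fact p.Prime]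
      (κ : ZpExtension ℚ p) (S₀ : Finset (HeightOneSpectrum (𝓞 ℚ)))
      (Φ₀ : AddSubgroup (W.geomTorsion (p : ℤ))) (hΦ : IsRationalLine W p Φ₀),
      p ≠ 2 → κ.IsCyclotomic → ¬ LineUnramifiedAt W p Φ₀ → LineEven W p Φ₀ →
      (∀ v ∈ S₀, ((p : ℕ) : 𝓞 ℚ) ∉ v.asIdeal) →
      (∀ v : HeightOneSpectrum (𝓞 ℚ), v ∉ S₀ → ((p : ℕ) : 𝓞 ℚ) ∉ v.asIdeal →
        W.HasGoodReductionAt v) →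
      GVLiftingInput W p κ S₀ Φ₀ hΦ)
    (hAn : ∀ (W : WeierstrassCurve ℚ) [W.IsGloballyMinimal] [W.IsElliptic] (p : ℕ) [Fact p.Prime]
      (κ : ZpExtension ℚ p) {N : ℕ} [NeZero N] (f : CuspForm (Gamma0 N) 2)
      (S₀ : Finset (HeightOneSpectrum (𝓞 ℚ)))
      (Φ₀ : AddSubgroup (W.geomTorsion (p : ℤ))) (hΦ : IsRationalLine W p Φ₀),
      p ≠ 2 → W.HasMultiplicativeReductionAtPrime p → κ.IsCyclotomic →
      ¬ LineUnramifiedAt W p Φ₀ → LineEven W p Φ₀ → IsNewformOf W f →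
      (∀ v ∈ S₀, ((p : ℕ) : 𝓞 ℚ) ∉ v.asIdeal) →
      (∀ v : HeightOneSpectrum (𝓞 ℚ), v ∉ S₀ → ((p : ℕ) : 𝓞 ℚ) ∉ v.asIdeal →
        W.HasGoodReductionAt v) →
      GVAnalyticInput W p κ f S₀ Φ₀ hΦ)
    (hP : cor38_realPeriodRat_eq_unit_mul_of_isIsogenous_of_gvPar)
    (W : WeierstrassCurve ℚ) [W.IsElliptic] [W.IsGloballyMinimal] (p : ℕ) [Fact p.Prime]
    {κ : ZpExtension ℚ p} {γ : absoluteGaloisGroup ℚ} {N : ℕ} [NeZero N]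
    {f : CuspForm (Gamma0 N) 2}
    (hp : p ≠ 2) (hmult : W.HasMultiplicativeReductionAtPrime p)
    {Φ₀ : AddSubgroup (W.geomTorsion (p : ℤ))} (hΦ : IsRationalLine W p Φ₀)
    (hunr : LineUnramifiedAt W p Φ₀) (hodd : LineOdd W p Φ₀)
    (hκ : κ.IsCyclotomic) (hγ : κ.IsTopGenerator γ) (hf : IsNewformOf W f)
    (D : W.SelmerDualData κ γ) (ϖ : ℚ) (hϖ : (ϖ : ℝ) * W.realPeriodRat = plusPeriod f)
    (fE : IwasawaAlgebra p) (hchar : D.charIdeal = Ideal.span {fE}) :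
    (W.HasSplitMultiplicativeReductionAtPrime p →
        ∀ (L : PowerSeries ℚ_[p]), IsSplitMultPAdicLFunctionOf f p L →
        ∀ (b : IwasawaAlgebra p), iwasawaToPowerSeries p b = PowerSeries.C ((ϖ : ℚ) : ℚ_[p]) * L →
          HasUnitContent b ∧
            (PowerSeries.map (PadicInt.toZMod (p := p)) b).order =
              (PowerSeries.map (PadicInt.toZMod (p := p)) (PowerSeries.X * fE)).order) ∧
      (¬ W.HasSplitMultiplicativeReductionAtPrime p →
        ∀ (L : PowerSeries ℚ_[p]), IsMultPAdicLFunctionOf f p (-1) L →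
        ∀ (b : IwasawaAlgebra p), iwasawaToPowerSeries p b = PowerSeries.C ((ϖ : ℚ) : ℚ_[p]) * L →
          HasUnitContent b ∧
            (PowerSeries.map (PadicInt.toZMod (p := p)) b).order =
              (PowerSeries.map (PadicInt.toZMod (p := p)) fE).order) := by
  -- the quotient `E' = E/Φ₀` on a globally minimal model, with its ramified-even line
  obtain ⟨W', _, _, g, hker, -⟩ := exists_isogeny_ker_eq_line hΦ
  obtain ⟨Φ', hΦ', hram', heven'⟩ :=
    exists_rationalLine_ramified_even_of_isogeny hT hT' hp hmult hΦ hunr hodd g hker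
  have hiso : IsIsogenous W W' := ⟨g⟩
  have hmult' : W'.HasMultiplicativeReductionAtPrime p :=
    hasMultiplicativeReductionAtPrime_of_isIsogenous hiso hmult
  have hsplit_iff : W.HasSplitMultiplicativeReductionAtPrime p ↔
      W'.HasSplitMultiplicativeReductionAtPrime p :=
    hasSplitMultiplicativeReductionAtPrime_iff_of_isIsogenous hiso
  have hf' : IsNewformOf W' f := hf.of_isIsogenous hiso.symm_of_charZero
  have hgv : GVPar W p := ⟨Φ₀, hΦ, Or.inr ⟨hunr, hodd⟩⟩
  have hgv' : GVPar W' p := ⟨Φ', hΦ', Or.inl ⟨hram', heven'⟩⟩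
  -- the period: `Ω_{E'} = u · Ω_E`, `|u|_p = 1` (GV Cor. (3.8))
  obtain ⟨u, hu1, hΩ⟩ := hP W W' p hp hf (Or.inr hmult) hiso hgv hgv'
  have hu0 : (u : ℚ_[p]) ≠ 0 := fun h ↦ by simp [h] at hu1
  have hu0' : u ≠ 0 := fun h ↦ hu0 (by rw [h, Rat.cast_zero])
  set cU : ℤ_[p]ˣ := PadicInt.mkUnits hu1 with hcU
  have hcUinv : (((cU⁻¹ : ℤ_[p]ˣ) : ℤ_[p]) : ℚ_[p]) = (u : ℚ_[p])⁻¹ := by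
    apply eq_inv_of_mul_eq_one_left
    rw [← PadicInt.mkUnits_eq hu1, ← PadicInt.coe_mul, Units.inv_mul, PadicInt.coe_one]
  have hϖ' : ((ϖ / u : ℚ) : ℝ) * W'.realPeriodRat = plusPeriod f := by
    rw [hΩ, Rat.cast_div, ← hϖ, ← mul_assoc,
      div_mul_cancel₀ _ (by exact_mod_cast hu0' : (u : ℝ) ≠ 0)]
  -- a dual datum for `E'`; `μ = 0` on both sides (Prop. 5.10); `λ(E) = λ(E')` (isogeny invariance)
  obtain ⟨D'⟩ := W'.nonempty_selmerDualData_holds κ γ hγ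
  haveI := WeierstrassCurve.SelmerDualData.module_finite_of_isCyclotomic W κ hκ D hγ
  haveI := WeierstrassCurve.SelmerDualData.module_finite_of_isCyclotomic W' κ hκ D' hγ
  obtain ⟨hX, fE₀, hchar₀, huf₀⟩ := hG.of_mult W p hp hmult hgv hκ hγ D
  obtain ⟨hX', fE', hchar', huf'⟩ := hG.of_mult W' p hp hmult' hgv' hκ hγ D'
  have hμ : D.mu = 0 := (mu_eq_zero_iff_hasUnitContent D hX hchar₀).mpr huf₀
  have hμ' : D'.mu = 0 := (mu_eq_zero_iff_hasUnitContent D' hX' hchar').mpr huf'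
  have hord : (PowerSeries.map (PadicInt.toZMod (p := p)) fE).order =
      (PowerSeries.map (PadicInt.toZMod (p := p)) fE').order := by
    rw [← natCast_lambdaInvariant_eq_order_map_toZMod D hX hμ hchar,
      ← natCast_lambdaInvariant_eq_order_map_toZMod D' hX' hμ' hchar',
      lambdaInvariant_eq_of_isogeny g D D']
  -- CASE 1 for `E'`
  have hcl' := caseOne_clause_of_inputs hT hT' hA hB hF hG hLift hAn W' p hp hmult' hΦ' hram' heven'
    hκ hγ hf' D' (ϖ / u) hϖ' fE' hchar'
  -- transport of `b`: `b' = C(c⁻¹)·b` has `ι b' = (ϖ/u)·L`, and `b = C(c)·b'`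
  have key : ∀ (L : PowerSeries ℚ_[p]) (b : IwasawaAlgebra p),
      iwasawaToPowerSeries p b = PowerSeries.C ((ϖ : ℚ) : ℚ_[p]) * L →
      iwasawaToPowerSeries p (PowerSeries.C ((cU⁻¹ : ℤ_[p]ˣ) : ℤ_[p]) * b) =
          PowerSeries.C (((ϖ / u : ℚ)) : ℚ_[p]) * L ∧
        b = PowerSeries.C ((cU : ℤ_[p]ˣ) : ℤ_[p]) * (PowerSeries.C ((cU⁻¹ : ℤ_[p]ˣ) : ℤ_[p]) * b) := by
    intro L b hιb
    refine ⟨?_, ?_⟩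
    · rw [iwasawaToPowerSeries_C_mul, hιb, ← mul_assoc, ← map_mul, Rat.cast_div, div_eq_inv_mul,
        hcUinv]
    · rw [← mul_assoc, ← map_mul, Units.mul_inv, map_one, one_mul]
  refine ⟨fun hsplit L hL b hιb ↦ ?_, fun hns L hL b hιb ↦ ?_⟩
  · obtain ⟨hιb', hb⟩ := key L b hιb
    obtain ⟨hub', hord'⟩ := hcl'.1 (hsplit_iff.mp hsplit) L hL _ hιb'
    obtain ⟨hC1, hC2⟩ := hasUnitContent_and_order_C_mul cU
      (PowerSeries.C ((cU⁻¹ : ℤ_[p]ˣ) : ℤ_[p]) * b)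
    refine ⟨?_, ?_⟩
    · rw [hb]; exact hC1.mpr hub'
    · rw [hb, hC2, hord', map_mul, map_mul, PowerSeries.order_mul, PowerSeries.order_mul, hord]
  · obtain ⟨hιb', hb⟩ := key L b hιb
    obtain ⟨hub', hord'⟩ := hcl'.2 (fun h ↦ hns (hsplit_iff.mpr h)) L hL _ hιb'
    obtain ⟨hC1, hC2⟩ := hasUnitContent_and_order_C_mul cU
      (PowerSeries.C ((cU⁻¹ : ℤ_[p]ˣ) : ℤ_[p]) * b)
    refine ⟨?_, ?_⟩
    · rw [hb]; exact hC1.mpr hub'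
    · rw [hb, hC2, hord', hord]


/-! ## §3. The flag's named facts DERIVED -/

/-- **`GreenbergVatsal2000.lambda_muAnal_multiplicative_of_gvPar` (A64: the exact content of the
cell's flag `GV00-mult-asserted`) DERIVED** — both parity cases — from the registered published
named facts A40/A41 (Tate uniformisation), A133, A135, A137 (GV §1–§2 at `p ‖ N`), Greenberg 1999
Prop. 5.10, GV Cor. (3.8) (`hP`), and the two TYPED printed inputs `X2.GVLiftingInput` (GV p. 28/30)
/ `X2.GVAnalyticInput` (GV Thm. (3.11) + (28) + p. 43) at every admissible CASE-1 datum: CASE 1 is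
gen 17's `caseOne_clause_of_inputs`, CASE 2 is `caseTwo_clause_of_inputs` (GV p. 28 isogeny
reduction, kernel `λ`-invariance, Cor. (3.8)). [cite: GreenbergVatsal2000, Thm. (1.3), §2 (16) and p. 28, §3 Thm. (3.11) and Cor. (3.8)] -/
theorem lambda_muAnal_multiplicative_of_gvPar_of_inputs
    (hT : Silverman1994_thmV53_tateUniformisation.{0})
    (hT' : Silverman1994_thmV53_corV54_tateUniformisation.{0})
    (hA : lambda_nonPrimitive_eq_add_sum_delta_multiplicative)
    (hB : datumSelmer_divisible_of_finite_torsionBy)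
    (hF : datumStrictSelmer_lt_datumSelmer_of_split)
    (hG : Greenberg1999.prop510_isTorsion_hasUnitContent_of_gvPar)
    (hLift : ∀ (W : WeierstrassCurve ℚ) [W.IsGloballyMinimal] [W.IsElliptic] (p : ℕ) [Fact p.Prime]
      (κ : ZpExtension ℚ p) (S₀ : Finset (HeightOneSpectrum (𝓞 ℚ)))
      (Φ₀ : AddSubgroup (W.geomTorsion (p : ℤ))) (hΦ : IsRationalLine W p Φ₀),
      p ≠ 2 → κ.IsCyclotomic → ¬ LineUnramifiedAt W p Φ₀ → LineEven W p Φ₀ →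
      (∀ v ∈ S₀, ((p : ℕ) : 𝓞 ℚ) ∉ v.asIdeal) →
      (∀ v : HeightOneSpectrum (𝓞 ℚ), v ∉ S₀ → ((p : ℕ) : 𝓞 ℚ) ∉ v.asIdeal →
        W.HasGoodReductionAt v) →
      GVLiftingInput W p κ S₀ Φ₀ hΦ)
    (hAn : ∀ (W : WeierstrassCurve ℚ) [W.IsGloballyMinimal] [W.IsElliptic] (p : ℕ) [Fact p.Prime]
      (κ : ZpExtension ℚ p) {N : ℕ} [NeZero N] (f : CuspForm (Gamma0 N) 2)
      (S₀ : Finset (HeightOneSpectrum (𝓞 ℚ)))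
      (Φ₀ : AddSubgroup (W.geomTorsion (p : ℤ))) (hΦ : IsRationalLine W p Φ₀),
      p ≠ 2 → W.HasMultiplicativeReductionAtPrime p → κ.IsCyclotomic →
      ¬ LineUnramifiedAt W p Φ₀ → LineEven W p Φ₀ → IsNewformOf W f →
      (∀ v ∈ S₀, ((p : ℕ) : 𝓞 ℚ) ∉ v.asIdeal) →
      (∀ v : HeightOneSpectrum (𝓞 ℚ), v ∉ S₀ → ((p : ℕ) : 𝓞 ℚ) ∉ v.asIdeal →
        W.HasGoodReductionAt v) →
      GVAnalyticInput W p κ f S₀ Φ₀ hΦ)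
    (hP : cor38_realPeriodRat_eq_unit_mul_of_isIsogenous_of_gvPar) :
    lambda_muAnal_multiplicative_of_gvPar := by
  intro W _ _ p _ κ γ N _ f hp hmult hpar hκ hγ _hγ' hf D ϖ hϖ fE hchar
  obtain ⟨Φ₀, hΦ, hcase⟩ := hpar
  rcases hcase with ⟨hram, heven⟩ | ⟨hunr, hodd⟩
  · exact caseOne_clause_of_inputs hT hT' hA hB hF hG hLift hAn W p hp hmult hΦ hram heven hκ hγ hf D
      ϖ hϖ fE hchar
  · exact caseTwo_clause_of_inputs hT hT' hA hB hF hG hLift hAn hP W p hp hmult hΦ hunr hodd hκ hγ hf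
      D ϖ hϖ fE hchar

/-- **`GreenbergVatsal2000.lambdaMu_multiplicative_of_gvPar` (A63, the monolithic GV-at-`p ‖ N`
fact: torsion, `char X = (f_E)` with `μ = 0`, `L_p(E) ∈ Λ`, `μ(L_p) = 0`, `λ(L_p) = λ(f_E) + e`)
DERIVED** from the same inputs plus Wuthrich 2014 Thm. 16 (`hWu`), by the tree's
`lambdaMu_multiplicative_of_gvPar_of_parts`. So the X2a closure of record
`X2.RankZero.targetA_of_published` (and every other consumer of A63/A64: the rank-one X2c levers
`mainConjecture_{split,nonsplit}_of_gvPar`, …) now runs on registered published facts + the two typed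
GV inputs + Cor. (3.8). [cite: GreenbergVatsal2000, Thm. (1.3), §2 (16), p. 28, §3 Thm. (3.11), Cor. (3.8)]
[cite: Wuthrich2014, Thm. 16 (p. 397)] [cite: GreenbergLNM1716, Prop. 5.10 (PDF p. 147)] -/
theorem lambdaMu_multiplicative_of_gvPar_of_inputs
    (hT : Silverman1994_thmV53_tateUniformisation.{0})
    (hT' : Silverman1994_thmV53_corV54_tateUniformisation.{0})
    (hA : lambda_nonPrimitive_eq_add_sum_delta_multiplicative)
    (hB : datumSelmer_divisible_of_finite_torsionBy)
    (hF : datumStrictSelmer_lt_datumSelmer_of_split)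
    (hG : Greenberg1999.prop510_isTorsion_hasUnitContent_of_gvPar)
    (hLift : ∀ (W : WeierstrassCurve ℚ) [W.IsGloballyMinimal] [W.IsElliptic] (p : ℕ) [Fact p.Prime]
      (κ : ZpExtension ℚ p) (S₀ : Finset (HeightOneSpectrum (𝓞 ℚ)))
      (Φ₀ : AddSubgroup (W.geomTorsion (p : ℤ))) (hΦ : IsRationalLine W p Φ₀),
      p ≠ 2 → κ.IsCyclotomic → ¬ LineUnramifiedAt W p Φ₀ → LineEven W p Φ₀ →
      (∀ v ∈ S₀, ((p : ℕ) : 𝓞 ℚ) ∉ v.asIdeal) →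
      (∀ v : HeightOneSpectrum (𝓞 ℚ), v ∉ S₀ → ((p : ℕ) : 𝓞 ℚ) ∉ v.asIdeal →
        W.HasGoodReductionAt v) →
      GVLiftingInput W p κ S₀ Φ₀ hΦ)
    (hAn : ∀ (W : WeierstrassCurve ℚ) [W.IsGloballyMinimal] [W.IsElliptic] (p : ℕ) [Fact p.Prime]
      (κ : ZpExtension ℚ p) {N : ℕ} [NeZero N] (f : CuspForm (Gamma0 N) 2)
      (S₀ : Finset (HeightOneSpectrum (𝓞 ℚ)))
      (Φ₀ : AddSubgroup (W.geomTorsion (p : ℤ))) (hΦ : IsRationalLine W p Φ₀),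
      p ≠ 2 → W.HasMultiplicativeReductionAtPrime p → κ.IsCyclotomic →
      ¬ LineUnramifiedAt W p Φ₀ → LineEven W p Φ₀ → IsNewformOf W f →
      (∀ v ∈ S₀, ((p : ℕ) : 𝓞 ℚ) ∉ v.asIdeal) →
      (∀ v : HeightOneSpectrum (𝓞 ℚ), v ∉ S₀ → ((p : ℕ) : 𝓞 ℚ) ∉ v.asIdeal →
        W.HasGoodReductionAt v) →
      GVAnalyticInput W p κ f S₀ Φ₀ hΦ)
    (hP : cor38_realPeriodRat_eq_unit_mul_of_isIsogenous_of_gvPar)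
    (hWu : Wuthrich2014.thm16_charIdeal_dvd_multiplicative_of_reducible) :
    lambdaMu_multiplicative_of_gvPar :=
  lambdaMu_multiplicative_of_gvPar_of_parts hWu hG
    (lambda_muAnal_multiplicative_of_gvPar_of_inputs hT hT' hA hB hF hG hLift hAn hP)

end Summit.BirchSwinnertonDyer.Rank1Residual.X2.GreenbergVatsalCaseTwo

end
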